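import Summits.Ventures.CertifiedManyBodySolver.Observables.DWaveOrderParameterCeiling
import Summits.Ventures.CertifiedManyBodySolver.Observables.TorusPairLROCeilingUniform
import Summits.Ventures.CertifiedManyBodySolver.Observables.TorusPairLROCeilingChemPotBracket
import HarnessLib

/-!
# OP1-C in IDENTITY FORM, part 6: ONE supporting chemical potential suffices for Koma–Tasaki's torus ceiling;
# a grand-canonical one-point cell at a CERTIFIED point of the subdifferential (half filling: `μ₀ = U/2`) bounds the
# order parameter `m⋆(μ₀)` AND the torus pair LRO of ALL large tori, uniformly in the ground state

HONEST FRAMING: soundness / bookkeeping theorems for a CEILING route at positivity scale; a ceiling never speaks to the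
presence of pairing; not a superconductivity verdict; nothing in this file is a number and NO grand-canonical one-point
certificate exists yet — the file says what ONE such certificate would prove. Crew hubbard-obs (D-0042), seat hubbard-obs-p1
(`prover-hubbard-obs-p1-g12-0`), PAIRCORR-SDP §20. Zero compute; no definition; no named fact; no `sorry`.

hubbard-cq-p4's torus theorem (`TorusPairLROCeiling.eventually_torusDiagonal_le_of_sectorGroundStates`, KT93 Thm 7.3 on the
summit's sector class) asks for `m⋆(t',U,μ)² ≤ c` at EVERY chemical potential `μ` supporting a density-`n` minimiser, and
hubbard-obs-gs-2's bracket form (`…_of_forall_mem_Icc`) for every `μ ∈ [μ₋(n), μ₊(n)]`. But a density-`n` minimiser at one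
supporting `μ` is a minimiser at EVERY `μ₀ ∈ [μ₋(n), μ₊(n)]` (`IsTranslationInvariant.isMeanEnergyMinimiser_hubbardTTPrimeMu_of_mem_Icc`,
gs-2's «every subgradient supports»), and the zero-field Koma–Tasaki ceiling `ZeroFieldPairLROCeiling t' U μ₀` bounds the box pair
LRO of every minimiser at `μ₀` by `m⋆(μ₀)²`. Hence:

* §1 `TorusPairLROCeiling.eventually_torusDiagonal_le_of_sectorGroundStates_at` — **ONE `μ₀ ∈ [μ₋(n), μ₊(n)]` with
  `m⋆(μ₀)² ≤ c` suffices**: along every family of unit `(rectN n L, S^z = 0)`-sector ground states, `∀ ε > 0`, eventually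
  `s_L ≤ c + ε` (`s_L = torusDiagonal g_d L ψ = L⁻⁴ Re⟨ψ, Δ_d†Δ_d ψ⟩`); `…exists_forall_sectorGroundStates_torusDiagonal_le_at` —
  the UNIFORM form: `∃ L₀ ∀ L ≥ L₀`, EVERY unit sector ground state of the `L`-torus has `s_L ≤ c + ε` (cq's `exists_forall_le_of_seq`).
* §2 `dWaveOrderParameterTT'_le_of_gcCell_at` — ONE grand-canonical one-point cell `(μg, Δg)` containing `μ₀` (cap priced from a
  certified canonical cap `e(n₀) ≤ hi`, part 5 §3) gives `m⋆(μ₀) ≤ M`; `gcCell_imp_densityCell` — a grand-canonical cell sentence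
  implies the density-`n₀` cell sentence of part 2 (so the registry leaf follows by `ObsPairLROCeilingAt_of_groundStateClass_cell_at`).
* §3 `exists_forall_sectorGroundStates_torusDiagonal_le_of_gcCell_at` — ONE grand-canonical cell at a CERTIFIED `μ₀ ∈ [μ₋(n), μ₊(n)]`
  ⇒ for all large `L` every unit density-`n` sector ground state has `s_L ≤ M² + ε`; with a `μ`-COVER of a certified envelope
  (`…_of_gcCells`) the same at any anchor.
* §4 HALF FILLING, `t' = 0` (`μ₀ = U/2`, `half_mem_Icc_chemPot_one`): **ONE grand-canonical one-point certificate at the grid point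
  `μ' = U/2` — in the degenerate cell `Δ = 0` the charged stationarity rows and charged `kkt` blocks are EXACT, no auxiliary
  certificate, no cover — certifies `m⋆(U/2) ≤ M` (`dWaveOrderParameterTT'_halfCoupling_le_of_gcCell`), the uniform all-large-tori
  ceiling `s_L ≤ M² + ε` on EVERY half-filled sector ground state (`exists_forall_sectorGroundStates_torusDiagonal_le_halfFilling_of_gcCell`)
  and the registry leaf `ObsPairLROCeilingAt 0 U 1 c'` (`ObsPairLROCeilingAt_halfFilling_of_gcCell`).** Cost of such a certificate ≈ ONE
  gauge-broken one-point solve of the row-24/row-68 class (PAIRCORR-SDP §20); its value would sit at positivity scale like every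
  one-point number of the cell — the file only settles WHAT it would certify.

References: T. Koma, H. Tasaki, Commun. Math. Phys. 158 (1993) 191, Theorem 7.3 [KomaTasaki1993]; T. Koma, H. Tasaki, J. Stat.
Phys. 76 (1994) 745, §1 [KomaTasaki1994]; O. Bratteli, A. Kishimoto, D. W. Robinson, Commun. Math. Phys. 64 (1978) 41, Thm. 2
[BratteliKishimotoRobinson1978]; D. Ruelle, *Statistical Mechanics* (1969) §3.4 [Ruelle1969]; E. H. Lieb, F. Y. Wu, Physica A 321
(2003) 1, §7 [LiebWuPhysicaA2003].
-/

noncomputable section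

open Matrix Complex Finset Literature.MathematicalPhysics.QuantumLattice Literature.Probability.LatticeModels
open Literature.MathematicalPhysics.QuantumLattice.HubbardWave0 ThermodynamicLimit Filter Topology Set
open scoped ComplexOrder ComplexConjugate BigOperators

/-! ### §1  ONE supporting chemical potential suffices (sequence form and uniform form) -/

namespace Summit.Ventures.CertifiedManyBodySolver.Observables.TorusPairLROCeiling

section OneMu

variable {ψ : ∀ L, Fock (Orb (FermionTorus 2 L))} {Ls : ℕ → ℕ} [∀ j, NeZero (Ls j)] {t' U n : ℝ}

/-- **KT93 Thm 7.3 on the summit's sector class from ONE supporting chemical potential.** `U ≥ 0`, `0 < n < 2`,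
`μ₀ ∈ [μ₋(n), μ₊(n)]`, `m⋆(t',U,μ₀)² ≤ c`. Then for unit `(rectN n L, S^z = 0)`-sector ground states of
`hubbardTorusTT' (Ls j) 1 t' U` along `L_j → ∞`: `∀ ε > 0`, eventually `s_{L_j} ≤ c + ε`. (Every torus limit is a
translation-invariant density-`n` minimiser at some supporting `μ`, hence — every subgradient supports — at `μ₀`; the
zero-field Koma–Tasaki ceiling at `μ₀` bounds its box pair LRO by `m⋆(μ₀)²`; cq's passage brings it down to the torus.)
[cite: KomaTasaki1993, Theorem 7.3] [cite: Ruelle1969, §3.4] -/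
theorem eventually_torusDiagonal_le_of_sectorGroundStates_at (hU : 0 ≤ U) (hn0 : 0 < n) (hn2 : n < 2)
    (hLs : Tendsto Ls atTop atTop)
    (hψ : ∀ j, IsGroundStateInSector (hubbardTorusTT' (Ls j) 1 t' U) (rectN n (Ls j)) 0 (ψ (Ls j)))
    (hunit : ∀ j, star (ψ (Ls j)) ⬝ᵥ ψ (Ls j) = 1) {μ₀ c : ℝ}
    (hμ₀ : μ₀ ∈ Set.Icc (chemPotMinusTT' 1 t' U n) (chemPotPlusTT' 1 t' U n))
    (hc : dWaveOrderParameterTT' t' U μ₀ ^ 2 ≤ c) {ε : ℝ} (hε : 0 < ε) :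
    ∀ᶠ j in atTop, torusDiagonal dWaveFormFactor (Ls j) (ψ (Ls j)) ≤ c + ε := by
  refine eventually_torusDiagonal_le_of_torusLimitCeiling dWaveFormFactor hLs hunit ?_ hε
  intro φ hφ ω hω δ hδ
  haveI : ∀ k, NeZero ((Ls ∘ φ) k) := fun k => inferInstanceAs (NeZero (Ls (φ k)))
  have hLs' : Tendsto (Ls ∘ φ) atTop atTop := hLs.comp hφ.tendsto_atTop
  obtain ⟨hTI, -, hρ, -, μ, hμ⟩ := hω.symmetric_groundState_of_sectorGroundStates t' hU hn0 hn2 hLs'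
    (fun j => hψ (φ j)) (fun j => hunit (φ j))
  have hme := isMeanEnergyMinimiser_meanEnergy_eq_energyDensityTT' hU hn0 hn2 hμ hρ
  have hμ₀' : ω.IsMeanEnergyMinimiser (hubbardTTPrimeMuInteraction 1 t' U μ₀) 1 :=
    hTI.isMeanEnergyMinimiser_hubbardTTPrimeMu_of_mem_Icc 1 t' hU hn0 hn2 hρ hme hμ₀
  have hceil := SourcedTorusAHM.zeroFieldPairLROCeiling_holds t' U μ₀ hμ₀' δ hδ
  filter_upwards [hceil] with N hN
  exact hN.trans (by linarith)

/-- **UNIFORM FORM: ONE supporting chemical potential ⇒ ALL large tori, every sector ground state.** `U ≥ 0`,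
`0 < n < 2`, `μ₀ ∈ [μ₋(n), μ₊(n)]`, `m⋆(t',U,μ₀)² ≤ c`: `∀ ε > 0 ∃ L₀ ∀ L ≥ L₀`, EVERY unit ground state `ψ` of
`hubbardTorusTT' L 1 t' U` in the sector `(rectN n L, S^z = 0)` has `L⁻⁴ Re⟨ψ, Δ_d†Δ_d ψ⟩ ≤ c + ε`.
[cite: KomaTasaki1993, Theorem 7.3] [cite: Ruelle1969, §3.4] -/
theorem exists_forall_sectorGroundStates_torusDiagonal_le_at (t' : ℝ) (hU : 0 ≤ U) (hn0 : 0 < n) (hn2 : n < 2)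
    {μ₀ c : ℝ} (hμ₀ : μ₀ ∈ Set.Icc (chemPotMinusTT' 1 t' U n) (chemPotPlusTT' 1 t' U n))
    (hc : dWaveOrderParameterTT' t' U μ₀ ^ 2 ≤ c) {ε : ℝ} (hε : 0 < ε) :
    ∃ L₀ : ℕ, ∀ (L : ℕ) [NeZero L], L₀ ≤ L → ∀ ψ : Fock (Orb (FermionTorus 2 L)), star ψ ⬝ᵥ ψ = 1 →
      IsGroundStateInSector (hubbardTorusTT' L 1 t' U) (rectN n L) 0 ψ →
      torusDiagonal dWaveFormFactor L ψ ≤ c + ε := by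
  obtain ⟨L₀, hL₀⟩ := exists_forall_le_of_seq
    (P := fun L _ ψ => star ψ ⬝ᵥ ψ = 1 ∧ IsGroundStateInSector (hubbardTorusTT' L 1 t' U) (rectN n L) 0 ψ)
    (F := fun L _ ψ => torusDiagonal dWaveFormFactor L ψ) (b := c + ε)
    (fun Ls hLs _ ψ hP =>
      eventually_torusDiagonal_le_of_sectorGroundStates_at hU hn0 hn2 hLs.tendsto_atTop
        (fun j => (hP j).2) (fun j => (hP j).1) hμ₀ hc hε)
  exact ⟨L₀, fun L _ hL ψ h1 h2 => hL₀ L hL ψ ⟨h1, h2⟩⟩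

end OneMu

end Summit.Ventures.CertifiedManyBodySolver.Observables.TorusPairLROCeiling

namespace Summit.Ventures.CertifiedManyBodySolver.Observables

open Literature.MathematicalPhysics.QuantumManyBody.StateRelaxation

/-! ### §2  ONE grand-canonical cell containing `μ₀` bounds `m⋆(μ₀)`; a GC cell sentence implies the density cell sentence -/

section OneCell

/-- **ONE grand-canonical one-point cell ⇒ `m⋆(μ₀) ≤ M`.** `U ≥ 0`; a cell `(μg, Δg)` with `|μg − μ₀| ≤ Δg`; a certified
canonical cap `e(n₀) ≤ hi` (`0 ≤ n₀ < 2`) pricing the cell cap `ug ≥ hi − μg·n₀ + Δg·max(n₀, 2 − n₀)`; the grand-canonical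
cell sentence «every TI minimiser of `H^{tt'} − μ_c N`, `|μg − μ_c| ≤ Δg`, with `e^{src}_{μg,0} ≤ ug` has `Re ω(P₀^d) ≤ M`»
(`two_mul_re_expect_localPairAt_le_of_chargedCell_certificate_gc`). Then the Koma–Tasaki order parameter obeys
`dWaveOrderParameterTT' t' U μ₀ ≤ M`. (In the degenerate cell `Δg = 0`, `μg = μ₀`, the charged rows are exact.)
[cite: KomaTasaki1994, §1] [cite: BratteliKishimotoRobinson1978, Thm. 2 (p. 47)] -/
theorem dWaveOrderParameterTT'_le_of_gcCell_at {tp U : ℝ} (hU : 0 ≤ U) {μ₀ : ℝ} (μg Δg ug M n₀ hi : ℝ)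
    (hn0 : 0 ≤ n₀) (hn2 : n₀ < 2) (hhi : energyDensityTT' 1 tp U n₀ ≤ hi) (hnear : |μg - μ₀| ≤ Δg)
    (hug : hi - μg * n₀ + Δg * max n₀ (2 - n₀) ≤ ug)
    (hcell : ∀ μc : ℝ, |μg - μc| ≤ Δg → ∀ ω : InfVolFermionState 2,
      ω.IsMeanEnergyMinimiser (hubbardTTPrimeSourcedInteraction 1 tp U μc dWaveFormFactor 0) 1 →
      ω.meanEnergy (hubbardTTPrimeSourcedInteraction 1 tp U μg dWaveFormFactor 0) 1 ≤ ug →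
        (ω.expect (pairRegion (insert (0 : Site 2) unitSteps) 0)
          (localPairAt (insert (0 : Site 2) unitSteps) dWaveFormFactor 0)).re ≤ M) :
    dWaveOrderParameterTT' tp U μ₀ ≤ M :=
  dWaveOrderParameterTT'_le_of_gcCells hU (μlo := μ₀) (μhi := μ₀) (Finset.univ : Finset Unit) (fun _ => μg)
    (fun _ => Δg) (fun _ => ug) (fun _ => M) (fun _ => n₀) (fun _ => hi) (fun _ _ => hn0) (fun _ _ => hn2)
    (fun _ _ => hhi) (fun μ hμ => ⟨(), Finset.mem_univ _, by rw [show μ = μ₀ from le_antisymm hμ.2 hμ.1]; exact hnear⟩)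
    (fun _ _ => hug) (fun _ _ => hcell) (fun _ _ => le_rfl) ⟨le_rfl, le_rfl⟩

/-- **A grand-canonical cell sentence implies the density-`n₀` cell sentence** of part 2 (`ObsPairLROCeilingAt_of_groundStateClass_cells`)
with the canonical cap `u = hi`: for a TI minimiser of density `n₀` with `e^{tt'}(ω) ≤ hi` the sourced energy at the grid point is
`e^{tt'}(ω) − μg·n₀ ≤ hi − μg·n₀ ≤ ug`. [cite: BratteliKishimotoRobinson1978, Thm. 2 (p. 47)] -/
theorem gcCell_imp_densityCell {tp U : ℝ} (μg Δg ug M n₀ hi : ℝ) (hn0 : 0 ≤ n₀)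
    (hug : hi - μg * n₀ + Δg * max n₀ (2 - n₀) ≤ ug)
    (hcell : ∀ μc : ℝ, |μg - μc| ≤ Δg → ∀ ω : InfVolFermionState 2,
      ω.IsMeanEnergyMinimiser (hubbardTTPrimeSourcedInteraction 1 tp U μc dWaveFormFactor 0) 1 →
      ω.meanEnergy (hubbardTTPrimeSourcedInteraction 1 tp U μg dWaveFormFactor 0) 1 ≤ ug →
        (ω.expect (pairRegion (insert (0 : Site 2) unitSteps) 0)
          (localPairAt (insert (0 : Site 2) unitSteps) dWaveFormFactor 0)).re ≤ M) :
    ∀ μc : ℝ, |μg - μc| ≤ Δg → ∀ ω : InfVolFermionState 2,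
      ω.IsMeanEnergyMinimiser (hubbardTTPrimeSourcedInteraction 1 tp U μc dWaveFormFactor 0) 1 →
      ω.density = n₀ → ω.meanEnergy (hubbardTTPrimeFermionInteraction 1 tp U) 1 ≤ hi →
        (ω.expect (pairRegion (insert (0 : Site 2) unitSteps) 0)
          (localPairAt (insert (0 : Site 2) unitSteps) dWaveFormFactor 0)).re ≤ M := by
  intro μc hμc ω hmin hρ he
  have hΔ : 0 ≤ Δg := (abs_nonneg _).trans hμc
  have hmax : 0 ≤ max n₀ (2 - n₀) := le_max_of_le_left hn0
  refine hcell μc hμc ω hmin ?_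
  rw [InfVolFermionState.meanEnergy_hubbardTTPrimeSourced, zero_mul, sub_zero, hρ]
  linarith [mul_nonneg hΔ hmax]

end OneCell

/-! ### §3  ONE grand-canonical cell at a CERTIFIED point of the subdifferential ⇒ ALL large tori; covers likewise -/

section Torus

/-- **ONE grand-canonical cell at a certified `μ₀ ∈ [μ₋(n), μ₊(n)]` ⇒ the uniform all-large-tori ceiling.** `U ≥ 0`, `0 < n < 2`;
hypotheses of `dWaveOrderParameterTT'_le_of_gcCell_at` (so `0 ≤ m⋆(μ₀) ≤ M`). Then `∀ ε > 0 ∃ L₀ ∀ L ≥ L₀`, every unit ground state `ψ` of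
`hubbardTorusTT' L 1 t' U` in the sector `(rectN n L, S^z = 0)` has `L⁻⁴ Re⟨ψ, Δ_d†Δ_d ψ⟩ ≤ M² + ε`.
[cite: KomaTasaki1993, Theorem 7.3] [cite: KomaTasaki1994, §1] -/
theorem exists_forall_sectorGroundStates_torusDiagonal_le_of_gcCell_at {tp U n : ℝ} (hU : 0 ≤ U) (hn0 : 0 < n)
    (hn2 : n < 2) {μ₀ : ℝ} (hμ₀ : μ₀ ∈ Set.Icc (chemPotMinusTT' 1 tp U n) (chemPotPlusTT' 1 tp U n))
    (μg Δg ug M n₀ hi : ℝ) (hn0' : 0 ≤ n₀) (hn2' : n₀ < 2) (hhi : energyDensityTT' 1 tp U n₀ ≤ hi)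
    (hnear : |μg - μ₀| ≤ Δg) (hug : hi - μg * n₀ + Δg * max n₀ (2 - n₀) ≤ ug)
    (hcell : ∀ μc : ℝ, |μg - μc| ≤ Δg → ∀ ω : InfVolFermionState 2,
      ω.IsMeanEnergyMinimiser (hubbardTTPrimeSourcedInteraction 1 tp U μc dWaveFormFactor 0) 1 →
      ω.meanEnergy (hubbardTTPrimeSourcedInteraction 1 tp U μg dWaveFormFactor 0) 1 ≤ ug →
        (ω.expect (pairRegion (insert (0 : Site 2) unitSteps) 0)
          (localPairAt (insert (0 : Site 2) unitSteps) dWaveFormFactor 0)).re ≤ M)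
    {ε : ℝ} (hε : 0 < ε) :
    ∃ L₀ : ℕ, ∀ (L : ℕ) [NeZero L], L₀ ≤ L → ∀ ψ : Fock (Orb (FermionTorus 2 L)), star ψ ⬝ᵥ ψ = 1 →
      IsGroundStateInSector (hubbardTorusTT' L 1 tp U) (rectN n L) 0 ψ →
      torusDiagonal dWaveFormFactor L ψ ≤ M ^ 2 + ε := by
  have hm : dWaveOrderParameterTT' tp U μ₀ ≤ M :=
    dWaveOrderParameterTT'_le_of_gcCell_at hU μg Δg ug M n₀ hi hn0' hn2' hhi hnear hug hcell
  have hsq : dWaveOrderParameterTT' tp U μ₀ ^ 2 ≤ M ^ 2 :=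
    pow_le_pow_left₀ (dWaveOrderParameterTT'_nonneg tp U μ₀) hm 2
  exact TorusPairLROCeiling.exists_forall_sectorGroundStates_torusDiagonal_le_at tp hU hn0 hn2 hμ₀ hsq hε

/-- **A grand-canonical `μ`-COVER of a certified envelope `[μlo, μhi] ⊇ [μ₋(n), μ₊(n)]` ⇒ the uniform all-large-tori ceiling
`B² + ε`** (hypotheses of `dWaveOrderParameterTT'_le_of_gcCells`): the OP1-GC cover product is the pair-LRO leaf, the
order-parameter ceiling on the bracket AND this uniform torus sentence. [cite: KomaTasaki1993, Theorem 7.3] [cite: KomaTasaki1994, §1] -/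
theorem exists_forall_sectorGroundStates_torusDiagonal_le_of_gcCells {tp U n : ℝ} (hU : 0 ≤ U) (hn0 : 0 < n)
    (hn2 : n < 2) {μlo μhi : ℝ} (hμlo : μlo ≤ chemPotMinusTT' 1 tp U n) (hμhi : chemPotPlusTT' 1 tp U n ≤ μhi)
    {J : Type*} (cells : Finset J) (μg Δg ug M n₀ hi : J → ℝ) (hn0' : ∀ j ∈ cells, 0 ≤ n₀ j)
    (hn2' : ∀ j ∈ cells, n₀ j < 2) (hhi : ∀ j ∈ cells, energyDensityTT' 1 tp U (n₀ j) ≤ hi j)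
    (hcover : ∀ μ ∈ Set.Icc μlo μhi, ∃ j ∈ cells, |μg j - μ| ≤ Δg j)
    (hug : ∀ j ∈ cells, hi j - μg j * n₀ j + Δg j * max (n₀ j) (2 - n₀ j) ≤ ug j)
    (hcell : ∀ j ∈ cells, ∀ μc : ℝ, |μg j - μc| ≤ Δg j → ∀ ω : InfVolFermionState 2,
      ω.IsMeanEnergyMinimiser (hubbardTTPrimeSourcedInteraction 1 tp U μc dWaveFormFactor 0) 1 →
      ω.meanEnergy (hubbardTTPrimeSourcedInteraction 1 tp U (μg j) dWaveFormFactor 0) 1 ≤ ug j →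
        (ω.expect (pairRegion (insert (0 : Site 2) unitSteps) 0)
          (localPairAt (insert (0 : Site 2) unitSteps) dWaveFormFactor 0)).re ≤ M j)
    {B : ℝ} (hB : ∀ j ∈ cells, M j ≤ B) {ε : ℝ} (hε : 0 < ε) :
    ∃ L₀ : ℕ, ∀ (L : ℕ) [NeZero L], L₀ ≤ L → ∀ ψ : Fock (Orb (FermionTorus 2 L)), star ψ ⬝ᵥ ψ = 1 →
      IsGroundStateInSector (hubbardTorusTT' L 1 tp U) (rectN n L) 0 ψ →
      torusDiagonal dWaveFormFactor L ψ ≤ B ^ 2 + ε := by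
  obtain ⟨μ₀, hμ₀⟩ : ∃ μ₀, μ₀ ∈ Set.Icc (chemPotMinusTT' 1 tp U n) (chemPotPlusTT' 1 tp U n) :=
    ⟨chemPotMinusTT' 1 tp U n, le_rfl, chemPotMinusTT'_le_chemPotPlusTT' 1 tp hU hn0 hn2⟩
  have hm : dWaveOrderParameterTT' tp U μ₀ ≤ B :=
    dWaveOrderParameterTT'_le_of_gcCells hU cells μg Δg ug M n₀ hi hn0' hn2' hhi hcover hug hcell hB
      ⟨hμlo.trans hμ₀.1, hμ₀.2.trans hμhi⟩
  have hsq : dWaveOrderParameterTT' tp U μ₀ ^ 2 ≤ B ^ 2 :=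
    pow_le_pow_left₀ (dWaveOrderParameterTT'_nonneg tp U μ₀) hm 2
  exact TorusPairLROCeiling.exists_forall_sectorGroundStates_torusDiagonal_le_at tp hU hn0 hn2 hμ₀ hsq hε

end Torus

/-! ### §4  HALF FILLING, `t' = 0`: ONE grand-canonical certificate at `μ' = U/2` -/

section HalfFilling

/-- **`m⋆(U/2) ≤ M` from ONE grand-canonical cell around `U/2`** (`t' = 0`, `U ≥ 0`): cap priced from a certified
half-filling cap `e(1,0,U,1) ≤ hi` as `ug ≥ hi − μg + Δg`; the degenerate cell `μg = U/2`, `Δg = 0` (charged rows EXACT, no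
auxiliary certificate, no cover) is allowed. [cite: KomaTasaki1994, §1] [cite: LiebWuPhysicaA2003, §7] -/
theorem dWaveOrderParameterTT'_halfCoupling_le_of_gcCell {U : ℝ} (hU : 0 ≤ U) (μg Δg ug M hi : ℝ)
    (hhi : energyDensityTT' 1 0 U 1 ≤ hi) (hnear : |μg - U / 2| ≤ Δg) (hug : hi - μg + Δg ≤ ug)
    (hcell : ∀ μc : ℝ, |μg - μc| ≤ Δg → ∀ ω : InfVolFermionState 2,
      ω.IsMeanEnergyMinimiser (hubbardTTPrimeSourcedInteraction 1 0 U μc dWaveFormFactor 0) 1 →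
      ω.meanEnergy (hubbardTTPrimeSourcedInteraction 1 0 U μg dWaveFormFactor 0) 1 ≤ ug →
        (ω.expect (pairRegion (insert (0 : Site 2) unitSteps) 0)
          (localPairAt (insert (0 : Site 2) unitSteps) dWaveFormFactor 0)).re ≤ M) :
    dWaveOrderParameterTT' 0 U (U / 2) ≤ M :=
  dWaveOrderParameterTT'_le_of_gcCell_at hU μg Δg ug M 1 hi zero_le_one one_lt_two hhi hnear
    (by rw [show max (1 : ℝ) (2 - 1) = 1 by norm_num]; linarith) hcell

/-- **HALF FILLING, ALL LARGE TORI from ONE grand-canonical certificate at `μ' = U/2`** (`t' = 0`, `U ≥ 0`):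
`∀ ε > 0 ∃ L₀ ∀ L ≥ L₀`, EVERY unit ground state of `hubbardTorusTT' L 1 0 U` in the half-filled sector `(rectN 1 L, S^z = 0)` has
`L⁻⁴ Re⟨ψ, Δ_d†Δ_d ψ⟩ ≤ M² + ε` — particle–hole symmetry certifies `U/2 ∈ [μ₋(1), μ₊(1)]` (`half_mem_Icc_chemPot_one`), so §3
applies with no chemical-potential bracket. [cite: KomaTasaki1993, Theorem 7.3] [cite: LiebWuPhysicaA2003, §7] -/
theorem exists_forall_sectorGroundStates_torusDiagonal_le_halfFilling_of_gcCell {U : ℝ} (hU : 0 ≤ U)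
    (μg Δg ug M hi : ℝ) (hhi : energyDensityTT' 1 0 U 1 ≤ hi) (hnear : |μg - U / 2| ≤ Δg) (hug : hi - μg + Δg ≤ ug)
    (hcell : ∀ μc : ℝ, |μg - μc| ≤ Δg → ∀ ω : InfVolFermionState 2,
      ω.IsMeanEnergyMinimiser (hubbardTTPrimeSourcedInteraction 1 0 U μc dWaveFormFactor 0) 1 →
      ω.meanEnergy (hubbardTTPrimeSourcedInteraction 1 0 U μg dWaveFormFactor 0) 1 ≤ ug →
        (ω.expect (pairRegion (insert (0 : Site 2) unitSteps) 0)
          (localPairAt (insert (0 : Site 2) unitSteps) dWaveFormFactor 0)).re ≤ M)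
    {ε : ℝ} (hε : 0 < ε) :
    ∃ L₀ : ℕ, ∀ (L : ℕ) [NeZero L], L₀ ≤ L → ∀ ψ : Fock (Orb (FermionTorus 2 L)), star ψ ⬝ᵥ ψ = 1 →
      IsGroundStateInSector (hubbardTorusTT' L 1 0 U) (rectN 1 L) 0 ψ →
      torusDiagonal dWaveFormFactor L ψ ≤ M ^ 2 + ε :=
  exists_forall_sectorGroundStates_torusDiagonal_le_of_gcCell_at hU one_pos one_lt_two (half_mem_Icc_chemPot_one 1 hU)
    μg Δg ug M 1 hi zero_le_one one_lt_two hhi hnear (by rw [show max (1 : ℝ) (2 - 1) = 1 by norm_num]; linarith)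
    hcell hε

/-- **HALF FILLING, the registry leaf from the same ONE grand-canonical certificate**: `ObsPairLROCeilingAt 0 U 1 c'` for every
rational `c' ≥ M²` (the grand-canonical cell sentence implies the density-1 cell sentence, `gcCell_imp_densityCell`; then
`ObsPairLROCeilingAt_halfFilling_of_groundStateClass_cell`). [cite: KomaTasaki1994, Theorem 5] [cite: LiebWuPhysicaA2003, §7] -/
theorem ObsPairLROCeilingAt_halfFilling_of_gcCell {U : ℝ} (hU : 0 ≤ U) (μg Δg ug M hi : ℝ)
    (hhi : energyDensityTT' 1 0 U 1 ≤ hi) (hnear : |μg - U / 2| ≤ Δg) (hug : hi - μg + Δg ≤ ug)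
    (hcell : ∀ μc : ℝ, |μg - μc| ≤ Δg → ∀ ω : InfVolFermionState 2,
      ω.IsMeanEnergyMinimiser (hubbardTTPrimeSourcedInteraction 1 0 U μc dWaveFormFactor 0) 1 →
      ω.meanEnergy (hubbardTTPrimeSourcedInteraction 1 0 U μg dWaveFormFactor 0) 1 ≤ ug →
        (ω.expect (pairRegion (insert (0 : Site 2) unitSteps) 0)
          (localPairAt (insert (0 : Site 2) unitSteps) dWaveFormFactor 0)).re ≤ M)
    {c' : ℚ} (hc' : M ^ 2 ≤ (c' : ℝ)) :
    ObsPairLROCeilingAt 0 U 1 c' :=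
  ObsPairLROCeilingAt_halfFilling_of_groundStateClass_cell hU hhi μg Δg M hnear
    (gcCell_imp_densityCell μg Δg ug M 1 hi zero_le_one
      (by rw [show max (1 : ℝ) (2 - 1) = 1 by norm_num]; linarith) hcell) hc'

end HalfFilling

end Summit.Ventures.CertifiedManyBodySolver.Observables

end
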